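import Summits.BirchSwinnertonDyer.Rank1Residual.Additive.X3DegenerateDisplayKitLayer
import Summits.BirchSwinnertonDyer.Rank1Residual.Iwasawa.CyclotomicLayerOneCubic
import HarnessLib

/-!
# X3, the DEGENERATE rows at `p = 3`, rank `0`, OFF the sub-locus: the layer-one DISPLAY KIT in
# INTEGER-TABLE form (cell `bsd-eis`, seat `bsd-eis-x3` gen 7; sequel of `X3DegenerateDisplayKitLayer.lean`;
# route K1 `AdditiveBranchIMC`, crux `GordTwoRankZeroOffCaseOne` — supports only)

HONEST FRAMING (`run/shared/lean/pub/bsd-eis/README.md` §4): THEOREMS ONLY; nothing is booked. This file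
re-packages `ClassX3Gord.bsdp_three_degenerate_display_layer[_of_record]` so that every identity in the
first layer `ℚ(ζ₉)⁺ = ℚ(θ)`, `θ = ζ + ζ⁸`, `θ³ = 3θ − 1`, that a per-pair display has to certify (Galois
conjugates of the `Σ₀`-units `P_i(θ)`, the local cubes `P_i(θ_j)·D_{ij}(θ)³ = 1 + 9·T_{ij}(θ)`, the norms
`P_i(θ)P_i(θ₁)P_i(θ₂) = n_i`, the support of `n_i`) becomes an identity between INTEGER coefficient
triples — multiplication in `ℤ[t]/(t³ − 3t + 1)` written out on coefficients — which the display
discharges by `decide`. The arithmetic: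
* `ev_mul` — `(a₀ + a₁θ + a₂θ²)(b₀ + b₁θ + b₂θ²) = c₀ + c₁θ + c₂θ²` with
  `c₀ = a₀b₀ − s₃`, `c₁ = a₀b₁ + a₁b₀ + 3s₃ − s₄`, `c₂ = a₀b₂ + a₁b₁ + a₂b₀ + 3s₄`,
  `s₃ = a₁b₂ + a₂b₁`, `s₄ = a₂b₂` (from `θ³ = 3θ − 1`, `θ⁴ = 3θ² − θ`);
* `ev_conj1` / `ev_conj2` — `P(θ² − 2) = (a₀ − 2a₁ + 4a₂) − a₂θ + (a₁ − a₂)θ²` and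
  `P(−θ² − θ + 2) = (a₀ + 2a₁ + 2a₂) + (a₂ − a₁)θ − a₁θ²` (the two non-trivial conjugates of `θ` are
  `θ² − 2` and `−θ² − θ + 2`);
* `ClassX3Gord.bsdp_three_degenerate_display_layerArith_of_record` / `…_layerArith` — the display
  shapes (NON-UNIT rows with ONE Q6 record `hrec`; UNIT rows), taking the tables `P, D, D2, D3, Tc, P01,
  nm, N₀` with `decide`-able hypotheses, and the cubic-residue certificate exactly as before.
References: [GreenbergVatsal2000] §2 pp. 26–30; [MazurTateTeitelbaum1986Invent] §I.10, §I.13;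
[Washington1997] §13.1.
-/

set_option autoImplicit false

noncomputable section

open scoped Classical AddSubgroup

namespace Summit.BirchSwinnertonDyer.Rank1Residual.Additive

open WeierstrassCurve NumberField IsDedekindDomain Field
  Literature.NumberTheory.EllipticCurves
  Literature.NumberTheory.EllipticCurves.ModularForms
  Literature.NumberTheory.EllipticCurves.GreenbergSelmer
  Literature.NumberTheory.EllipticCurves.GreenbergVatsal2000
  Literature.NumberTheory.EllipticCurves.Rank1Residual
  Literature.NumberTheory.EllipticCurves.Rank1Residual.Typed
  Literature.NumberTheory.GaloisRepresentations
  Summit.BirchSwinnertonDyer.Rank1Residual.X1.MuLambda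
  Summit.BirchSwinnertonDyer.Rank1Residual.AdditivePotMult
  Summit.BirchSwinnertonDyer.Rank1Residual.Additive.X3Branch

namespace X3DegenerateDisplayKitLayerArith

/-- **Multiplication in `ℤ[t]/(t³ − 3t + 1)` on coefficient triples**: if `θ³ = 3θ − 1` then
`(a₀ + a₁θ + a₂θ²)(b₀ + b₁θ + b₂θ²) = c₀ + c₁θ + c₂θ²` for the integer triple `c` written out in the
hypotheses (`θ⁴ = 3θ² − θ`). [folklore] -/
theorem ev_mul {A : Type*} [CommRing A] {θ : A} (hθ : θ ^ 3 = 3 * θ - 1) (a b : Fin 3 → ℤ)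
    (c0 c1 c2 : ℤ) (h0 : c0 = a 0 * b 0 - (a 1 * b 2 + a 2 * b 1))
    (h1 : c1 = a 0 * b 1 + a 1 * b 0 + 3 * (a 1 * b 2 + a 2 * b 1) - a 2 * b 2)
    (h2 : c2 = a 0 * b 2 + a 1 * b 1 + a 2 * b 0 + 3 * (a 2 * b 2)) :
    ((a 0 : A) + a 1 * θ + a 2 * θ ^ 2) * ((b 0 : A) + b 1 * θ + b 2 * θ ^ 2) =
      (c0 : A) + c1 * θ + c2 * θ ^ 2 := by
  rw [h0, h1, h2]
  push_cast
  linear_combination ((a 1 : A) * b 2 + (a 2 : A) * b 1 + (a 2 : A) * b 2 * θ) * hθ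

/-- **First conjugate**: `P(θ² − 2) = (a₀ − 2a₁ + 4a₂) − a₂θ + (a₁ − a₂)θ²` when `θ³ = 3θ − 1`
(`(θ² − 2)² = θ⁴ − 4θ² + 4 = −θ² − θ + 4`). [folklore] -/
theorem ev_conj1 {A : Type*} [CommRing A] {θ : A} (hθ : θ ^ 3 = 3 * θ - 1) (a : Fin 3 → ℤ)
    (b0 b1 b2 : ℤ) (h0 : b0 = a 0 - 2 * a 1 + 4 * a 2) (h1 : b1 = -a 2) (h2 : b2 = a 1 - a 2) :
    (a 0 : A) + a 1 * (θ ^ 2 - 2) + a 2 * (θ ^ 2 - 2) ^ 2 = (b0 : A) + b1 * θ + b2 * θ ^ 2 := by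
  rw [h0, h1, h2]
  push_cast
  linear_combination ((a 2 : ℤ) : A) * θ * hθ

/-- **Second conjugate**: `P(−θ² − θ + 2) = (a₀ + 2a₁ + 2a₂) + (a₂ − a₁)θ − a₁θ²` when `θ³ = 3θ − 1`
(`(−θ² − θ + 2)² = θ + 2`). [folklore] -/
theorem ev_conj2 {A : Type*} [CommRing A] {θ : A} (hθ : θ ^ 3 = 3 * θ - 1) (a : Fin 3 → ℤ)
    (b0 b1 b2 : ℤ) (h0 : b0 = a 0 + 2 * a 1 + 2 * a 2) (h1 : b1 = -a 1 + a 2) (h2 : b2 = -a 1) :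
    (a 0 : A) + a 1 * (-θ ^ 2 - θ + 2) + a 2 * (-θ ^ 2 - θ + 2) ^ 2 =
      (b0 : A) + b1 * θ + b2 * θ ^ 2 := by
  rw [h0, h1, h2]
  push_cast
  linear_combination ((a 2 : ℤ) : A) * (θ + 2) * hθ

/-- **Support from divisibility**: if `n ∣ N₀ ^ B` and every prime `v` containing `N₀` lies in `S₀`, then
every prime `v` containing `n` lies in `S₀`. [folklore] -/
theorem mem_of_natCast_mem_of_dvd_pow {S₀ : Finset (HeightOneSpectrum (𝓞 ℚ))} {N₀ B n : ℕ}
    (hN₀ : ∀ v : HeightOneSpectrum (𝓞 ℚ), ((N₀ : ℕ) : 𝓞 ℚ) ∈ v.asIdeal → v ∈ S₀) (hn : n ∣ N₀ ^ B)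
    (v : HeightOneSpectrum (𝓞 ℚ)) (hv : ((n : ℕ) : 𝓞 ℚ) ∈ v.asIdeal) : v ∈ S₀ := by
  obtain ⟨c, hc⟩ := hn
  refine hN₀ v (v.isPrime.mem_of_pow_mem B ?_)
  have h : ((N₀ ^ B : ℕ) : 𝓞 ℚ) ∈ v.asIdeal := by
    rw [hc, Nat.cast_mul]
    exact v.asIdeal.mul_mem_right _ hv
  exact_mod_cast h

end X3DegenerateDisplayKitLayerArith

open X3DegenerateDisplayKitLayerArith in
/-- **`BSD₃(W)` on a DEGENERATE X3♯(G-ord) row of rank `0`, OFF the sub-locus — DISPLAY SHAPE with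
layer-one units given by INTEGER TABLES (NON-UNIT rows: ONE Q6 record `hrec`).** Displayed: the 11
PUBLISHED records, ONE Cremona datum `hL : L(W,1) = q·Ω_W` (`q ≠ 0`), ONE Q6 record
`hrec : CensusQ6.GordOddFirstUnitIndexAt W 3 n`. KERNEL data (all `decide`-able but `S₀`, the torsion
point, `T`, `N₀`): `P` (units and their conjugates, `hconj`), `D, D2, D3, Tc` (cube certificates:
`D2 = D·D`, `D3 = D2·D`, `P·D3 = 1 + 9·Tc` coefficientwise in `ℤ[t]/(t³ − 3t + 1)`), `P01, nm`
(norms: `P01 = P₀·P₁`, `P01·P₂ = (nm, 0, 0)`), `N₀` with `nm_i ∣ N₀ ^ 64` and every prime above `N₀`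
in `S₀`, and the cubic-residue certificate `q, r, w, ω, e, Linv` of
`ClassX3Gord.bsdp_three_degenerate_display_layer_of_record`; `n + Σδ + 1 ≤ #T + k`.
[cite: GreenbergVatsal2000, §2 pp. 26–30] [cite: MazurTateTeitelbaum1986Invent, §I.10 (10.1), §I.13]
[cite: Washington1997, §13.1] -/
theorem _root_.Summit.BirchSwinnertonDyer.Rank1Residual.Additive.ClassX3Gord.bsdp_three_degenerate_display_layerArith_of_record
    [Fact (Nat.Prime 3)] {W : WeierstrassCurve ℚ} [W.IsElliptic] [W.IsGloballyMinimal]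
    (hTors : Greenberg1999.finite_torsion_cyclotomicZpExtension)
    (hDelG : Delbourgo1998.prop4_rankZero_constantCoeff_eq_unit_mul_of_potGoodOrd)
    (hDel98 : Delbourgo1998.prop4_rankZero_pow_dvd_constantCoeff)
    (hGZK : rank_eq_analyticRank_of_analyticRank_le_one) (hmod : hasEntireLFunction_rat)
    (hmodD : nonempty_modularParametrizationData)
    (hW16 : Wuthrich2014.thm16_halfEigenCharIdeal_dvd_cyclotomicPrime)
    (h23 : datumSelmer_nonPrimitive_invariants)
    (hRQ : datumSelmer_divisible_of_finite_torsionBy_of_gr_inertiaInvariants_eq_zero)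
    (hGrK : Greenberg1999.imKummer_ge_strictCondition_goodOrdinary)
    (hLiftE : residualEpsilon_surjOn_of_lineEven)
    (hX : ClassX3Gord W 3) {qL : ℚ} (hL : W.entireLFunction 1 = (qL : ℂ) * (W.realPeriodRat : ℂ))
    (hq0 : qL ≠ 0) {n : ℕ} (hrec : CensusQ6.GordOddFirstUnitIndexAt W 3 n)
    (S₀ : Finset (HeightOneSpectrum (𝓞 ℚ))) (hne : S₀.Nonempty)
    (hS₀ : ∀ v ∈ S₀, ((3 : ℕ) : 𝓞 ℚ) ∉ v.asIdeal)
    (hS : ∀ v : HeightOneSpectrum (𝓞 ℚ), v ∉ S₀ → ((3 : ℕ) : 𝓞 ℚ) ∉ v.asIdeal →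
      W.HasGoodReductionAt v)
    {x₀ y₀ : ℚ} (heq : y₀ ^ 2 + W.a₁ * x₀ * y₀ + W.a₃ * y₀ = x₀ ^ 3 + W.a₂ * x₀ ^ 2 + W.a₄ * x₀ + W.a₆)
    (hψ : W.Ψ₃.eval x₀ = 0) (hd : W.Ψ₂Sq.eval x₀ ≠ 0)
    (T : Finset ℕ) (hT : ∀ ℓ ∈ T, ℓ.Prime ∧ 3 ∣ ℓ - 1 ∧ ∃ v ∈ S₀, ((ℓ : ℕ) : 𝓞 ℚ) ∈ v.asIdeal)
    {k : ℕ} (P : Fin k → Fin 3 → Fin 3 → ℤ)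
    (hconj : ∀ i, P i 1 0 = P i 0 0 - 2 * P i 0 1 + 4 * P i 0 2 ∧ P i 1 1 = -P i 0 2 ∧
      P i 1 2 = P i 0 1 - P i 0 2 ∧ P i 2 0 = P i 0 0 + 2 * P i 0 1 + 2 * P i 0 2 ∧
      P i 2 1 = -P i 0 1 + P i 0 2 ∧ P i 2 2 = -P i 0 1)
    (D D2 D3 Tc : Fin k → Fin 3 → Fin 3 → ℤ)
    (hD2 : ∀ i j, D2 i j 0 = D i j 0 * D i j 0 - (D i j 1 * D i j 2 + D i j 2 * D i j 1) ∧
      D2 i j 1 = D i j 0 * D i j 1 + D i j 1 * D i j 0 + 3 * (D i j 1 * D i j 2 + D i j 2 * D i j 1) -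
        D i j 2 * D i j 2 ∧
      D2 i j 2 = D i j 0 * D i j 2 + D i j 1 * D i j 1 + D i j 2 * D i j 0 + 3 * (D i j 2 * D i j 2))
    (hD3 : ∀ i j, D3 i j 0 = D2 i j 0 * D i j 0 - (D2 i j 1 * D i j 2 + D2 i j 2 * D i j 1) ∧
      D3 i j 1 = D2 i j 0 * D i j 1 + D2 i j 1 * D i j 0 + 3 * (D2 i j 1 * D i j 2 + D2 i j 2 * D i j 1) -
        D2 i j 2 * D i j 2 ∧
      D3 i j 2 = D2 i j 0 * D i j 2 + D2 i j 1 * D i j 1 + D2 i j 2 * D i j 0 + 3 * (D2 i j 2 * D i j 2))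
    (hPD3 : ∀ i j, 1 + 9 * Tc i j 0 = P i j 0 * D3 i j 0 - (P i j 1 * D3 i j 2 + P i j 2 * D3 i j 1) ∧
      9 * Tc i j 1 = P i j 0 * D3 i j 1 + P i j 1 * D3 i j 0 + 3 * (P i j 1 * D3 i j 2 + P i j 2 * D3 i j 1) -
        P i j 2 * D3 i j 2 ∧
      9 * Tc i j 2 = P i j 0 * D3 i j 2 + P i j 1 * D3 i j 1 + P i j 2 * D3 i j 0 + 3 * (P i j 2 * D3 i j 2))
    (P01 : Fin k → Fin 3 → ℤ) (nm : Fin k → ℕ) (hn0 : ∀ i, nm i ≠ 0)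
    (hP01 : ∀ i, P01 i 0 = P i 0 0 * P i 1 0 - (P i 0 1 * P i 1 2 + P i 0 2 * P i 1 1) ∧
      P01 i 1 = P i 0 0 * P i 1 1 + P i 0 1 * P i 1 0 + 3 * (P i 0 1 * P i 1 2 + P i 0 2 * P i 1 1) -
        P i 0 2 * P i 1 2 ∧
      P01 i 2 = P i 0 0 * P i 1 2 + P i 0 1 * P i 1 1 + P i 0 2 * P i 1 0 + 3 * (P i 0 2 * P i 1 2))
    (hN : ∀ i, (nm i : ℤ) = P01 i 0 * P i 2 0 - (P01 i 1 * P i 2 2 + P01 i 2 * P i 2 1) ∧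
      (0 : ℤ) = P01 i 0 * P i 2 1 + P01 i 1 * P i 2 0 + 3 * (P01 i 1 * P i 2 2 + P01 i 2 * P i 2 1) -
        P01 i 2 * P i 2 2 ∧
      (0 : ℤ) = P01 i 0 * P i 2 2 + P01 i 1 * P i 2 1 + P01 i 2 * P i 2 0 + 3 * (P01 i 2 * P i 2 2))
    (N₀ : ℕ) (hN₀ : ∀ v : HeightOneSpectrum (𝓞 ℚ), ((N₀ : ℕ) : 𝓞 ℚ) ∈ v.asIdeal → v ∈ S₀)
    (hnm : ∀ i, nm i ∣ N₀ ^ 64)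
    {ζ : AlgebraicClosure ℚ} (hζ : IsPrimitiveRoot ζ 9)
    {R : ℕ} (q : Fin R → ℕ) (hq : ∀ ρ, (q ρ).Prime) (hq1 : ∀ ρ, 3 ∣ q ρ - 1)
    (r : (ρ : Fin R) → Fin 3 → ZMod (q ρ)) (hrr : ∀ ρ kk, r ρ kk ^ 3 - 3 * r ρ kk + 1 = 0)
    (w : (ρ : Fin R) → Fin 3 → Fin 3 → ZMod (q ρ))
    (hw : ∀ ρ (c c' : Fin 3), ∑ kk, w ρ c kk * r ρ kk ^ c'.val = if c = c' then 1 else 0)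
    (ω : (ρ : Fin R) → ZMod (q ρ)) (hω : ∀ ρ, ω ρ ^ 3 = 1 ∧ ω ρ ≠ 1)
    (e : Fin R → Fin k → ℕ)
    (he : ∀ ρ i, ((P i 0 0 : ZMod (q ρ)) + (P i 0 1 : ZMod (q ρ)) * r ρ 0 +
      (P i 0 2 : ZMod (q ρ)) * r ρ 0 ^ 2) ^ ((q ρ - 1) / 3) = ω ρ ^ e ρ i)
    (hnz : ∀ ρ i, (P i 0 0 : ZMod (q ρ)) + (P i 0 1 : ZMod (q ρ)) * r ρ 0 +
      (P i 0 2 : ZMod (q ρ)) * r ρ 0 ^ 2 ≠ 0)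
    (Linv : Fin k → Fin R → ℤ)
    (hLinv : ∀ i i', (∑ ρ, (Linv i ρ : ZMod 3) * (e ρ i' : ZMod 3)) = if i = i' then 1 else 0)
    (hcount : n + ∑ v ∈ S₀, delta W 3 v + 1 ≤ T.card + k) :
    BSDp W 3 := by
  have hθ : (ζ + ζ ^ 8) ^ 3 = 3 * (ζ + ζ ^ 8) - 1 := by
    linear_combination Summit.BirchSwinnertonDyer.Rank1Residual.Iwasawa.CyclotomicLayerOne.theta_cubic hζ
  refine ClassX3Gord.bsdp_three_degenerate_display_layer_of_record hTors hDelG hDel98 hGZK hmod hmodD hW16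
    h23 hRQ hGrK hLiftE hX hL hq0 hrec S₀ hne hS₀ hS heq hψ hd T hT hζ P ?_ ?_ D Tc ?_ nm hn0 ?_ ?_ q hq
    hq1 r hrr w hw ω hω e he hnz Linv hLinv hcount
  · -- first conjugates
    intro i
    obtain ⟨h0, h1, h2, -, -, -⟩ := hconj i
    exact ev_conj1 hθ (P i 0) _ _ _ h0 h1 h2
  · -- second conjugates
    intro i
    obtain ⟨-, -, -, h0, h1, h2⟩ := hconj i
    exact ev_conj2 hθ (P i 0) _ _ _ h0 h1 h2
  · -- local cubes `P_i(θ_j) · D_{ij}(θ)³ = 1 + 9 T_{ij}(θ)`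
    intro i j
    obtain ⟨a0, a1, a2⟩ := hD2 i j
    obtain ⟨b0, b1, b2⟩ := hD3 i j
    obtain ⟨c0, c1, c2⟩ := hPD3 i j
    have e2 := ev_mul hθ (D i j) (D i j) _ _ _ a0 a1 a2
    have e3 := ev_mul hθ (D2 i j) (D i j) _ _ _ b0 b1 b2
    have e4 := ev_mul hθ (P i j) (D3 i j) _ _ _ c0 c1 c2
    rw [pow_three, ← mul_assoc ((D i j 0 : AlgebraicClosure ℚ) + _ + _), e2, e3, e4]
    push_cast
    ring
  · -- norms `P_i(θ) P_i(θ₁) P_i(θ₂) = n_i`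
    intro i
    obtain ⟨a0, a1, a2⟩ := hP01 i
    obtain ⟨b0, b1, b2⟩ := hN i
    have e1 := ev_mul hθ (P i 0) (P i 1) _ _ _ a0 a1 a2
    have e2 := ev_mul hθ (P01 i) (P i 2) _ _ _ b0 b1 b2
    rw [← mul_assoc, e1, e2]
    push_cast
    ring
  · -- support of the norms
    intro i v hv
    exact mem_of_natCast_mem_of_dvd_pow hN₀ (hnm i) v hv

open X3DegenerateDisplayKitLayerArith in
/-- **UNIT rows** (`ord₃ q = 0`), integer-table form: the Q6 record at index `0` follows from the unit
`L`-value (`CensusQ6.gordOddFirstUnitIndexAt_zero_of_unitLValue`), so the display carries the 11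
PUBLISHED records + ONE Cremona datum `hL` only, under `Σδ + 1 ≤ #T + k`.
[cite: MazurTateTeitelbaum1986Invent, §I.10 (10.1), §I.13] [cite: GreenbergVatsal2000, §2 pp. 26–30] -/
theorem _root_.Summit.BirchSwinnertonDyer.Rank1Residual.Additive.ClassX3Gord.bsdp_three_degenerate_display_layerArith
    [Fact (Nat.Prime 3)] {W : WeierstrassCurve ℚ} [W.IsElliptic] [W.IsGloballyMinimal]
    (hTors : Greenberg1999.finite_torsion_cyclotomicZpExtension)
    (hDelG : Delbourgo1998.prop4_rankZero_constantCoeff_eq_unit_mul_of_potGoodOrd)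
    (hDel98 : Delbourgo1998.prop4_rankZero_pow_dvd_constantCoeff)
    (hGZK : rank_eq_analyticRank_of_analyticRank_le_one) (hmod : hasEntireLFunction_rat)
    (hmodD : nonempty_modularParametrizationData)
    (hW16 : Wuthrich2014.thm16_halfEigenCharIdeal_dvd_cyclotomicPrime)
    (h23 : datumSelmer_nonPrimitive_invariants)
    (hRQ : datumSelmer_divisible_of_finite_torsionBy_of_gr_inertiaInvariants_eq_zero)
    (hGrK : Greenberg1999.imKummer_ge_strictCondition_goodOrdinary)
    (hLiftE : residualEpsilon_surjOn_of_lineEven)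
    (hX : ClassX3Gord W 3) {qL : ℚ} (hL : W.entireLFunction 1 = (qL : ℂ) * (W.realPeriodRat : ℂ))
    (hq0 : qL ≠ 0) (hv : padicValRat 3 qL = 0)
    (S₀ : Finset (HeightOneSpectrum (𝓞 ℚ))) (hne : S₀.Nonempty)
    (hS₀ : ∀ v ∈ S₀, ((3 : ℕ) : 𝓞 ℚ) ∉ v.asIdeal)
    (hS : ∀ v : HeightOneSpectrum (𝓞 ℚ), v ∉ S₀ → ((3 : ℕ) : 𝓞 ℚ) ∉ v.asIdeal →
      W.HasGoodReductionAt v)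
    {x₀ y₀ : ℚ} (heq : y₀ ^ 2 + W.a₁ * x₀ * y₀ + W.a₃ * y₀ = x₀ ^ 3 + W.a₂ * x₀ ^ 2 + W.a₄ * x₀ + W.a₆)
    (hψ : W.Ψ₃.eval x₀ = 0) (hd : W.Ψ₂Sq.eval x₀ ≠ 0)
    (T : Finset ℕ) (hT : ∀ ℓ ∈ T, ℓ.Prime ∧ 3 ∣ ℓ - 1 ∧ ∃ v ∈ S₀, ((ℓ : ℕ) : 𝓞 ℚ) ∈ v.asIdeal)
    {k : ℕ} (P : Fin k → Fin 3 → Fin 3 → ℤ)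
    (hconj : ∀ i, P i 1 0 = P i 0 0 - 2 * P i 0 1 + 4 * P i 0 2 ∧ P i 1 1 = -P i 0 2 ∧
      P i 1 2 = P i 0 1 - P i 0 2 ∧ P i 2 0 = P i 0 0 + 2 * P i 0 1 + 2 * P i 0 2 ∧
      P i 2 1 = -P i 0 1 + P i 0 2 ∧ P i 2 2 = -P i 0 1)
    (D D2 D3 Tc : Fin k → Fin 3 → Fin 3 → ℤ)
    (hD2 : ∀ i j, D2 i j 0 = D i j 0 * D i j 0 - (D i j 1 * D i j 2 + D i j 2 * D i j 1) ∧
      D2 i j 1 = D i j 0 * D i j 1 + D i j 1 * D i j 0 + 3 * (D i j 1 * D i j 2 + D i j 2 * D i j 1) -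
        D i j 2 * D i j 2 ∧
      D2 i j 2 = D i j 0 * D i j 2 + D i j 1 * D i j 1 + D i j 2 * D i j 0 + 3 * (D i j 2 * D i j 2))
    (hD3 : ∀ i j, D3 i j 0 = D2 i j 0 * D i j 0 - (D2 i j 1 * D i j 2 + D2 i j 2 * D i j 1) ∧
      D3 i j 1 = D2 i j 0 * D i j 1 + D2 i j 1 * D i j 0 + 3 * (D2 i j 1 * D i j 2 + D2 i j 2 * D i j 1) -
        D2 i j 2 * D i j 2 ∧
      D3 i j 2 = D2 i j 0 * D i j 2 + D2 i j 1 * D i j 1 + D2 i j 2 * D i j 0 + 3 * (D2 i j 2 * D i j 2))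
    (hPD3 : ∀ i j, 1 + 9 * Tc i j 0 = P i j 0 * D3 i j 0 - (P i j 1 * D3 i j 2 + P i j 2 * D3 i j 1) ∧
      9 * Tc i j 1 = P i j 0 * D3 i j 1 + P i j 1 * D3 i j 0 + 3 * (P i j 1 * D3 i j 2 + P i j 2 * D3 i j 1) -
        P i j 2 * D3 i j 2 ∧
      9 * Tc i j 2 = P i j 0 * D3 i j 2 + P i j 1 * D3 i j 1 + P i j 2 * D3 i j 0 + 3 * (P i j 2 * D3 i j 2))
    (P01 : Fin k → Fin 3 → ℤ) (nm : Fin k → ℕ) (hn0 : ∀ i, nm i ≠ 0)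
    (hP01 : ∀ i, P01 i 0 = P i 0 0 * P i 1 0 - (P i 0 1 * P i 1 2 + P i 0 2 * P i 1 1) ∧
      P01 i 1 = P i 0 0 * P i 1 1 + P i 0 1 * P i 1 0 + 3 * (P i 0 1 * P i 1 2 + P i 0 2 * P i 1 1) -
        P i 0 2 * P i 1 2 ∧
      P01 i 2 = P i 0 0 * P i 1 2 + P i 0 1 * P i 1 1 + P i 0 2 * P i 1 0 + 3 * (P i 0 2 * P i 1 2))
    (hN : ∀ i, (nm i : ℤ) = P01 i 0 * P i 2 0 - (P01 i 1 * P i 2 2 + P01 i 2 * P i 2 1) ∧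
      (0 : ℤ) = P01 i 0 * P i 2 1 + P01 i 1 * P i 2 0 + 3 * (P01 i 1 * P i 2 2 + P01 i 2 * P i 2 1) -
        P01 i 2 * P i 2 2 ∧
      (0 : ℤ) = P01 i 0 * P i 2 2 + P01 i 1 * P i 2 1 + P01 i 2 * P i 2 0 + 3 * (P01 i 2 * P i 2 2))
    (N₀ : ℕ) (hN₀ : ∀ v : HeightOneSpectrum (𝓞 ℚ), ((N₀ : ℕ) : 𝓞 ℚ) ∈ v.asIdeal → v ∈ S₀)
    (hnm : ∀ i, nm i ∣ N₀ ^ 64)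
    {ζ : AlgebraicClosure ℚ} (hζ : IsPrimitiveRoot ζ 9)
    {R : ℕ} (q : Fin R → ℕ) (hq : ∀ ρ, (q ρ).Prime) (hq1 : ∀ ρ, 3 ∣ q ρ - 1)
    (r : (ρ : Fin R) → Fin 3 → ZMod (q ρ)) (hrr : ∀ ρ kk, r ρ kk ^ 3 - 3 * r ρ kk + 1 = 0)
    (w : (ρ : Fin R) → Fin 3 → Fin 3 → ZMod (q ρ))
    (hw : ∀ ρ (c c' : Fin 3), ∑ kk, w ρ c kk * r ρ kk ^ c'.val = if c = c' then 1 else 0)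
    (ω : (ρ : Fin R) → ZMod (q ρ)) (hω : ∀ ρ, ω ρ ^ 3 = 1 ∧ ω ρ ≠ 1)
    (e : Fin R → Fin k → ℕ)
    (he : ∀ ρ i, ((P i 0 0 : ZMod (q ρ)) + (P i 0 1 : ZMod (q ρ)) * r ρ 0 +
      (P i 0 2 : ZMod (q ρ)) * r ρ 0 ^ 2) ^ ((q ρ - 1) / 3) = ω ρ ^ e ρ i)
    (hnz : ∀ ρ i, (P i 0 0 : ZMod (q ρ)) + (P i 0 1 : ZMod (q ρ)) * r ρ 0 +
      (P i 0 2 : ZMod (q ρ)) * r ρ 0 ^ 2 ≠ 0)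
    (Linv : Fin k → Fin R → ℤ)
    (hLinv : ∀ i i', (∑ ρ, (Linv i ρ : ZMod 3) * (e ρ i' : ZMod 3)) = if i = i' then 1 else 0)
    (hcount : ∑ v ∈ S₀, delta W 3 v + 1 ≤ T.card + k) :
    BSDp W 3 :=
  ClassX3Gord.bsdp_three_degenerate_display_layerArith_of_record hTors hDelG hDel98 hGZK hmod hmodD hW16 h23
    hRQ hGrK hLiftE hX hL hq0
    (CensusQ6.gordOddFirstUnitIndexAt_zero_of_unitLValue hmod (by decide) hX.addv hL hq0 hv) S₀ hne hS₀ hS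
    heq hψ hd T hT P hconj D D2 D3 Tc hD2 hD3 hPD3 P01 nm hn0 hP01 hN N₀ hN₀ hnm hζ q hq hq1 r hrr w hw ω
    hω e he hnz Linv hLinv (by rwa [zero_add])

end Summit.BirchSwinnertonDyer.Rank1Residual.Additive

end
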